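import Summits.AtomisticToContinuum.BoseEinsteinCondensation.Theses.BECStronglyRayleigh
import Literature.MathematicalPhysics.QuantumLattice.LiebMattisSectorPF

/-!
# Crux `GroundStateStability` (stmt-AtomisticToContinuum-9672) — the window `|Δ| ≤ 1` cannot be widened

Crux-disprover result (route BECStronglyRayleigh, seat `refuter-cdisprove-stmt-AtomisticToContinuum-9672-0`).

`groundStateStability_false_with_window : ¬ GroundStateStabilityWithWindow (7/3)` — the crux statement
with its hypothesis `|Δ| ≤ 1` replaced by `|Δ| ≤ 7/3` is false (`GroundStateStabilityWithWindow 1` is the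
crux by `Iff.rfl`). Witness: the 4-cycle, two hard-core bosons, no field, `Δ = -7/3` (nearest-neighbour
repulsion `7/3 > 2J`): the sector ground vector `ψ₀` (`3` on the two diagonal pairs, `1` on the four edges;
`E_min = -3`, certified by the explicit sum of squares `⟨φ,(H₀+3)φ⟩ = 3Σ_i|a_i - (d₁+d₂)/6|² + ⅓|d₁-d₂|²`)
has occupation polynomial `3(z₀z₂+z₁z₃) + (z₀z₁+z₁z₂+z₂z₃+z₃z₀)`, which vanishes at
`(3+i, -4+2i, 3+i, -2+i) ∈ H⁴`.

By hand: on `C4`, `N = 2`, `μ = 0` the symmetric reduction is 2×2 (`E² - ΔE - 2 = 0`, `ψ = (a` diagonals`,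
b` edges`)`, `b/a = 1/|E|`), the pair kernel `circ(0,b,a,b)` has eigenvalues `2b+a, a-2b, -a, -a`, so the
ground vector is stable iff `Δ ≥ -1` EXACTLY; numerically the repulsive edge `Δ = -1` is sharp on every
bipartite graph tried (there the kernels are exactly degenerate-Lorentzian at `Δ = -1`, the `SU(2)` point),
while the attractive edge `Δ = +1` is sharp only asymptotically (paths `P₄…P₇`: first failure at
`Δ ≈ 1.64, 1.32, 1.20, 1.14`, the `K = 0` two-magnon bound-state threshold `Δ > 1` of the chain).

The occupation-basis action formula of the spin-½ XXZ bond used in §1 is a `private` copy of the tree's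
`gate_xxzBond_mulVec_apply` (`Theorems/BECStronglyRayleighGroundStateStabilityEulerGate.lean`, itself adapted from
this seat's crux workfile `Cruxes/GroundStateStability/Disproof.lean`), kept private here only to avoid an import
of the positive line into the Negative lane; §1 specialises it to the 4-cycle (`H_C4_apply`, `sum_sector`).
All [folklore] (finite computation).
-/

noncomputable section

namespace Summit.AtomisticToContinuum.BoseEinsteinCondensation.Theorems.GroundStateStability.Negative

open scoped BigOperators Matrix ComplexOrder
open Literature.MathematicalPhysics.QuantumLattice Matrix Complex

/-! ## §1 The XXZ Hamiltonian on the 4-cycle in the occupation basis -/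

section API

variable {Λ : Type*} [Fintype Λ] [DecidableEq Λ] in
/-- Two single-site operators at distinct sites act on two coordinates (private copy of the tree's
`gate_onSite_mul_onSite_mulVec_apply`). [folklore] -/
private theorem onSite_mul_onSite_mulVec_apply' {q : ℕ} {x y : Λ} (hxy : x ≠ y)
    (a b : Matrix (Fin q) (Fin q) ℂ) (φ : TensorIndex Λ q → ℂ) (σ : TensorIndex Λ q) :
    ((onSite x a * onSite y b : Op Λ q) *ᵥ φ) σ =
      ∑ l, ∑ m, a (σ x) l * b (σ y) m * φ (Function.update (Function.update σ x l) y m) := by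
  rw [← Matrix.mulVec_mulVec, LiebMattis.onSite_mulVec_apply]
  refine Finset.sum_congr rfl fun l _ => ?_
  rw [LiebMattis.onSite_mulVec_apply, Function.update_of_ne hxy.symm, Finset.mul_sum]
  refine Finset.sum_congr rfl fun m _ => ?_
  ring

variable {Λ : Type*} [Fintype Λ] [DecidableEq Λ] in
/-- Action of the spin-½ XXZ bond in the occupation basis (private copy of the tree's
`gate_xxzBond_mulVec_apply`): `Δ s_x s_y φ(σ) + ½[σ_x ≠ σ_y] φ(σ^{x↔y})`. [folklore] -/
private theorem xxzBond_mulVec_apply' {x y : Λ} (hxy : x ≠ y) (Δ : ℂ) (φ : TensorIndex Λ 2 → ℂ)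
    (σ : TensorIndex Λ 2) :
    ((spinBond 1 0 x y + spinBond 1 1 x y + Δ • spinBond 1 2 x y) *ᵥ φ) σ =
      Δ * (if σ x = σ y then (1 / 4 : ℂ) else -(1 / 4 : ℂ)) * φ σ +
        (if σ x = σ y then 0 else
          (1 / 2 : ℂ) * φ (Function.update (Function.update σ x (σ y)) y (σ x))) := by
  have key : ∀ i : Fin 2, i = 0 ∨ i = 1 := by decide
  have hcomm : ∀ (l m : Fin 2), Function.update (Function.update σ y m) x l =
      Function.update (Function.update σ x l) y m := fun l m => Function.update_comm hxy.symm _ _ _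
  simp only [spinBond, siteSpin, spinVec_one_eq_half_spinHalfPauli, Matrix.add_mulVec,
    Matrix.smul_mulVec, Pi.add_apply, Pi.smul_apply, smul_eq_mul,
    onSite_mul_onSite_mulVec_apply' hxy, onSite_mul_onSite_mulVec_apply' hxy.symm, hcomm,
    Matrix.smul_apply]
  have h1 : Function.update (Function.update σ x (σ x)) y (σ y) = σ := by
    simp only [Function.update_eq_self]
  rcases key (σ x) with hx | hx <;> rcases key (σ y) with hy | hy <;> rw [hx, hy] at h1 <;>
    simp [hx, hy, spinHalfPauli, h1] <;> ring_nf <;> simp [Complex.I_sq] <;> ring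


/-! ### The 4-cycle -/

/-- The 4-cycle `0 – 1 – 2 – 3 – 0`. -/
abbrev C4 : SimpleGraph (Fin 4) := SimpleGraph.cycleGraph 4

/-- The edge set of the 4-cycle. [folklore] -/
theorem C4_edgeFinset : C4.edgeFinset = {s(0, 1), s(1, 2), s(2, 3), s(3, 0)} := by
  decide

/-- Swap along the edge `{0,1}` on a vector literal. [folklore] -/
theorem update_swap_01 (a b c d : Fin 2) :
    Function.update (Function.update (![a, b, c, d] : Fin 4 → Fin 2) 0 b) 1 a = ![b, a, c, d] := by
  funext i; fin_cases i <;> simp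
/-- Swap along the edge `{1,2}` on a vector literal. [folklore] -/
theorem update_swap_12 (a b c d : Fin 2) :
    Function.update (Function.update (![a, b, c, d] : Fin 4 → Fin 2) 1 c) 2 b = ![a, c, b, d] := by
  funext i; fin_cases i <;> simp
/-- Swap along the edge `{2,3}` on a vector literal. [folklore] -/
theorem update_swap_23 (a b c d : Fin 2) :
    Function.update (Function.update (![a, b, c, d] : Fin 4 → Fin 2) 2 d) 3 c = ![a, b, d, c] := by
  funext i; fin_cases i <;> simp
/-- Swap along the edge `{3,0}` on a vector literal. [folklore] -/
theorem update_swap_30 (a b c d : Fin 2) :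
    Function.update (Function.update (![a, b, c, d] : Fin 4 → Fin 2) 3 a) 0 d = ![d, b, c, a] := by
  funext i; fin_cases i <;> simp

/-- parallel / antiparallel weight `q(u,v) = ±¼`. -/
def qq (u v : Fin 2) : ℂ := if u = v then (1 / 4 : ℂ) else -(1 / 4 : ℂ)
/-- hop indicator `[u ≠ v]/2`. -/
def hh (u v : Fin 2) : ℂ := if u = v then 0 else (1 / 2 : ℂ)

/-- **Master action formula**: the ferromagnetic XXZ Hamiltonian with zero field on the 4-cycle,
evaluated at the configuration `(a,b,c,d)`. -/
theorem H_C4_apply (Δ : ℝ) (φ : TensorIndex (Fin 4) 2 → ℂ) (a b c d : Fin 2) :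
    ((xxzHamiltonian 1 C4 (-1) Δ + ∑ x : Fin 4, (((fun _ : Fin 4 => (0 : ℝ)) x : ℝ) : ℂ) • siteSpin 1 x 2)
        *ᵥ φ) ![a, b, c, d] =
      -((Δ : ℂ) * (qq a b + qq b c + qq c d + qq d a) * φ ![a, b, c, d] +
        (hh a b * φ ![b, a, c, d] + hh b c * φ ![a, c, b, d] + hh c d * φ ![a, b, d, c] +
          hh d a * φ ![d, b, c, a])) := by
  have e01 : ((0 : Fin 4)) ≠ 1 := by decide
  have e12 : ((1 : Fin 4)) ≠ 2 := by decide
  have e23 : ((2 : Fin 4)) ≠ 3 := by decide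
  have e30 : ((3 : Fin 4)) ≠ 0 := by decide
  simp only [xxzHamiltonian, C4_edgeFinset, Complex.ofReal_zero, zero_smul, Finset.sum_const_zero,
    add_zero, Matrix.smul_mulVec, Pi.smul_apply, Matrix.sum_mulVec, Finset.sum_apply, smul_eq_mul]
  rw [Finset.sum_insert (by decide), Finset.sum_insert (by decide), Finset.sum_insert (by decide),
    Finset.sum_singleton]
  simp only [Sym2.lift_mk, xxzBond_mulVec_apply' e01, xxzBond_mulVec_apply' e12,
    xxzBond_mulVec_apply' e23, xxzBond_mulVec_apply' e30, qq, hh]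
  simp [update_swap_01, update_swap_12, update_swap_23, update_swap_30]
  split_ifs <;> ring

end API

/-! ## §2 The tightness witness -/

/-! ### The tightness witness at `Δ = -7/3` -/

/-- The field-free ferromagnetic XXZ Hamiltonian on the 4-cycle at `Δ = -7/3` (written exactly in
the shape the crux produces for `μ = 0`). -/
def H₀ : Op (Fin 4) 2 :=
  xxzHamiltonian 1 C4 (-1) (-7 / 3 : ℝ) +
    ∑ x : Fin 4, (((fun _ : Fin 4 => (0 : ℝ)) x : ℝ) : ℂ) • siteSpin 1 x 2

/-- The sector ground vector: `3` on the two diagonal pairs `{0,2}`, `{1,3}`, `1` on the four edges,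
`0` off the two-particle sector. -/
def ψ₀ : TensorIndex (Fin 4) 2 → ℂ := fun σ =>
  if (∑ z, (σ z : ℕ)) = 2 then (if σ 0 = σ 2 then 3 else 1) else 0

/-- Every configuration on four sites is a vector literal. [folklore] -/
theorem vec4_eta (σ : Fin 4 → Fin 2) : σ = ![σ 0, σ 1, σ 2, σ 3] := by
  funext i; fin_cases i <;> rfl

/-- `H₀ ψ₀ = -3 ψ₀`, configuration by configuration. -/
theorem H₀_mulVec_ψ₀_apply (a b c d : Fin 2) :
    (H₀ *ᵥ ψ₀) ![a, b, c, d] = (-3 : ℂ) * ψ₀ ![a, b, c, d] := by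
  rw [H₀, H_C4_apply]
  fin_cases a <;> fin_cases b <;> fin_cases c <;> fin_cases d <;>
    simp [ψ₀, qq, hh, Fin.sum_univ_four] <;> norm_num

/-- The eigen-equation `H₀ ψ₀ = -3 ψ₀`. [folklore] -/
theorem H₀_mulVec_ψ₀ : H₀ *ᵥ ψ₀ = (-3 : ℂ) • ψ₀ := by
  funext σ
  rw [vec4_eta σ, Pi.smul_apply, smul_eq_mul]
  exact H₀_mulVec_ψ₀_apply _ _ _ _

/-- `ψ₀` lies in the two-particle sector (`M = 4/2 - 2 = 0`). [folklore] -/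
theorem ψ₀_mem : ψ₀ ∈ spinZSector 1 (((Fintype.card (Fin 4) * 1 : ℕ) : ℝ) / 2 - (2 : ℕ)) :=
  (LiebMattis.mem_spinZSector_weight_iff 1 2 ψ₀).2 fun _ hσ => if_neg hσ

/-- `ψ₀ ≠ 0`. [folklore] -/
theorem ψ₀_ne_zero : ψ₀ ≠ 0 := by
  intro h
  have := congrFun h ![0, 1, 0, 1]
  simp [ψ₀, Fin.sum_univ_four] at this

/-- The six two-particle configurations. -/
def T6 : Finset (Fin 4 → Fin 2) :=
  {![0, 0, 1, 1], ![1, 0, 0, 1], ![1, 1, 0, 0], ![0, 1, 1, 0], ![0, 1, 0, 1], ![1, 0, 1, 0]}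

/-- The two-particle configurations are the six listed ones. [folklore] -/
theorem mem_T6_of_weight : ∀ σ : Fin 4 → Fin 2, (∑ z, (σ z : ℕ)) = 2 → σ ∈ T6 := by
  decide

/-- A sum of a function vanishing off the two-particle sector is the sum of its six sector values. -/
theorem sum_sector (f : (Fin 4 → Fin 2) → ℂ) (hf : ∀ σ, (∑ z, (σ z : ℕ)) ≠ 2 → f σ = 0) :
    ∑ σ, f σ = f ![0, 0, 1, 1] + f ![1, 0, 0, 1] + f ![1, 1, 0, 0] + f ![0, 1, 1, 0] +
      f ![0, 1, 0, 1] + f ![1, 0, 1, 0] := by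
  rw [← Finset.sum_subset (Finset.subset_univ T6)]
  · rw [T6, Finset.sum_insert (by decide), Finset.sum_insert (by decide), Finset.sum_insert (by decide),
      Finset.sum_insert (by decide), Finset.sum_insert (by decide), Finset.sum_singleton]
    ring
  · intro σ _ hσ
    exact hf σ fun h => hσ (mem_T6_of_weight σ h)

/-- **The sum-of-squares certificate** `⟨φ,(H₀+3)φ⟩ = 3Σ_i|a_i - s/6|² + ⅓|d₁-d₂|² ≥ 0` on the sector
(`a_i` the edge amplitudes, `d_j` the diagonal ones, `s = d₁+d₂`). -/
theorem quadForm_H₀ (φ : TensorIndex (Fin 4) 2 → ℂ) (hφ : ∀ σ, (∑ z, (σ z : ℕ)) ≠ 2 → φ σ = 0) :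
    (star φ ⬝ᵥ H₀ *ᵥ φ).re + 3 * (star φ ⬝ᵥ φ).re =
      3 * (((φ ![0, 0, 1, 1]).re - ((φ ![0, 1, 0, 1]).re + (φ ![1, 0, 1, 0]).re) / 6) ^ 2 +
            ((φ ![0, 0, 1, 1]).im - ((φ ![0, 1, 0, 1]).im + (φ ![1, 0, 1, 0]).im) / 6) ^ 2 +
          (((φ ![1, 0, 0, 1]).re - ((φ ![0, 1, 0, 1]).re + (φ ![1, 0, 1, 0]).re) / 6) ^ 2 +
            ((φ ![1, 0, 0, 1]).im - ((φ ![0, 1, 0, 1]).im + (φ ![1, 0, 1, 0]).im) / 6) ^ 2) +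
          (((φ ![1, 1, 0, 0]).re - ((φ ![0, 1, 0, 1]).re + (φ ![1, 0, 1, 0]).re) / 6) ^ 2 +
            ((φ ![1, 1, 0, 0]).im - ((φ ![0, 1, 0, 1]).im + (φ ![1, 0, 1, 0]).im) / 6) ^ 2) +
          (((φ ![0, 1, 1, 0]).re - ((φ ![0, 1, 0, 1]).re + (φ ![1, 0, 1, 0]).re) / 6) ^ 2 +
            ((φ ![0, 1, 1, 0]).im - ((φ ![0, 1, 0, 1]).im + (φ ![1, 0, 1, 0]).im) / 6) ^ 2)) +
        (1 / 3) * (((φ ![0, 1, 0, 1]).re - (φ ![1, 0, 1, 0]).re) ^ 2 +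
          ((φ ![0, 1, 0, 1]).im - (φ ![1, 0, 1, 0]).im) ^ 2) := by
  have h1 : ∀ σ, (∑ z, (σ z : ℕ)) ≠ 2 → star (φ σ) * (H₀ *ᵥ φ) σ = 0 := fun σ hσ => by
    rw [hφ σ hσ, star_zero, zero_mul]
  have h2 : ∀ σ, (∑ z, (σ z : ℕ)) ≠ 2 → star (φ σ) * φ σ = 0 := fun σ hσ => by
    rw [hφ σ hσ, star_zero, zero_mul]
  simp only [dotProduct, Pi.star_apply]
  rw [sum_sector _ h1, sum_sector _ h2]
  simp only [H₀, H_C4_apply, qq, hh]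
  simp [Complex.mul_re, Complex.mul_im]
  ring

/-- `⟨φ,(H₀+3)φ⟩ ≥ 0` on the sector. [folklore] -/
theorem quadForm_H₀_nonneg (φ : TensorIndex (Fin 4) 2 → ℂ) (hφ : ∀ σ, (∑ z, (σ z : ℕ)) ≠ 2 → φ σ = 0) :
    0 ≤ (star φ ⬝ᵥ H₀ *ᵥ φ).re + 3 * (star φ ⬝ᵥ φ).re := by
  rw [quadForm_H₀ φ hφ]
  positivity

/-- The sector energy is exactly `-3`. -/
theorem lowestEnergyInSector_H₀ :
    lowestEnergyInSector 1 H₀ (((Fintype.card (Fin 4) * 1 : ℕ) : ℝ) / 2 - (2 : ℕ)) = -3 := by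
  unfold lowestEnergyInSector Matrix.minEnergyOn
  set K := spinZSector (Λ := Fin 4) 1 (((Fintype.card (Fin 4) * 1 : ℕ) : ℝ) / 2 - (2 : ℕ)) with hK
  have hlow : ∀ E ∈ {E : ℝ | ∃ ψ ∈ K, star ψ ⬝ᵥ ψ = 1 ∧ E = (star ψ ⬝ᵥ H₀ *ᵥ ψ).re}, -3 ≤ E := by
    rintro E ⟨φ, hφK, hφ1, rfl⟩
    have hφ := (LiebMattis.mem_spinZSector_weight_iff 1 2 φ).1 hφK
    have h := quadForm_H₀_nonneg φ hφ
    rw [hφ1, Complex.one_re] at h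
    linarith
  have hmem : (-3 : ℝ) ∈ {E : ℝ | ∃ ψ ∈ K, star ψ ⬝ᵥ ψ = 1 ∧ E = (star ψ ⬝ᵥ H₀ *ᵥ ψ).re} := by
    obtain ⟨c, -, hc1⟩ := exists_smul_unit ψ₀_ne_zero
    refine ⟨c • ψ₀, K.smul_mem c ψ₀_mem, hc1, ?_⟩
    rw [Matrix.mulVec_smul, H₀_mulVec_ψ₀, smul_comm, dotProduct_smul, hc1]
    simp
  exact le_antisymm (csInf_le ⟨-3, hlow⟩ hmem) (le_csInf ⟨-3, hmem⟩ hlow)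

/-- The occupation polynomial of `ψ₀`, `3(z₀z₂ + z₁z₃) + (z₀z₁ + z₁z₂ + z₂z₃ + z₃z₀)`, vanishes at the
Gaussian-integer point `(3+i, -4+2i, 3+i, -2+i) ∈ H⁴`. -/
theorem ψ₀_poly_zero :
    (∑ S : Finset (Fin 4), ψ₀ (fun x => if x ∈ S then 0 else 1) *
        ∏ x ∈ S, (![3 + I, -4 + 2 * I, 3 + I, -2 + I] : Fin 4 → ℂ) x) = 0 := by
  have hvan : ∀ S : Finset (Fin 4), S ∉ ({{0, 1}, {0, 2}, {0, 3}, {1, 2}, {1, 3}, {2, 3}} : Finset (Finset (Fin 4))) →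
      (∑ z, (((fun x => if x ∈ S then (0 : Fin 2) else 1) z : Fin 2) : ℕ)) ≠ 2 := by
    decide
  rw [← Finset.sum_subset (Finset.subset_univ ({{0, 1}, {0, 2}, {0, 3}, {1, 2}, {1, 3}, {2, 3}} : Finset (Finset (Fin 4))))]
  · rw [Finset.sum_insert (by decide), Finset.sum_insert (by decide), Finset.sum_insert (by decide),
      Finset.sum_insert (by decide), Finset.sum_insert (by decide), Finset.sum_singleton,
      Finset.prod_pair (by decide), Finset.prod_pair (by decide), Finset.prod_pair (by decide),
      Finset.prod_pair (by decide), Finset.prod_pair (by decide), Finset.prod_pair (by decide)]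
    simp [ψ₀, Fin.sum_univ_four]
    ring_nf
    simp [Complex.I_sq]
  · intro S _ hS
    rw [ψ₀, if_neg (hvan S hS), zero_mul]

/-! ### The crux with a wider window is false -/

/-- The crux with the window `|Δ| ≤ 1` replaced by `|Δ| ≤ w`. -/
def GroundStateStabilityWithWindow (w : ℝ) : Prop :=
  ∀ (Λ : Type) [Fintype Λ] [DecidableEq Λ] (G : SimpleGraph Λ) [DecidableRel G.Adj], G.Connected →
    ∀ (Δ : ℝ) (μ : Λ → ℝ), |Δ| ≤ w → ∀ (M : ℝ) (ψ : TensorIndex Λ 2 → ℂ), ψ ∈ spinZSector 1 M → ψ ≠ 0 →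
      (xxzHamiltonian 1 G (-1) Δ + ∑ x : Λ, ((μ x : ℝ) : ℂ) • siteSpin 1 x 2).mulVec ψ =
        ((lowestEnergyInSector 1 (xxzHamiltonian 1 G (-1) Δ + ∑ x : Λ, ((μ x : ℝ) : ℂ) • siteSpin 1 x 2) M : ℝ) : ℂ) • ψ →
      ∀ z : Λ → ℂ, (∀ x, 0 < (z x).im) → (∑ S : Finset Λ, ψ (fun x => if x ∈ S then 0 else 1) * ∏ x ∈ S, z x) ≠ 0

/-- `GroundStateStabilityWithWindow 1` is the crux, verbatim. [folklore] -/
theorem groundStateStabilityWithWindow_one_iff :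
    GroundStateStabilityWithWindow 1 ↔
      Summit.AtomisticToContinuum.BoseEinsteinCondensation.Theses.BECStronglyRayleigh.GroundStateStability :=
  Iff.rfl

/-- **The window cannot be widened to `|Δ| ≤ 7/3`** (repulsive side, `Δ = -7/3`, 4-cycle, two
particles, no field): the sector ground vector `ψ₀` has an occupation polynomial with a zero in `H⁴`. -/
theorem groundStateStability_false_with_window : ¬ GroundStateStabilityWithWindow (7 / 3) := by
  intro h
  have hH : (xxzHamiltonian 1 C4 (-1) (-7 / 3 : ℝ) +
      ∑ x : Fin 4, (((fun _ : Fin 4 => (0 : ℝ)) x : ℝ) : ℂ) • siteSpin 1 x 2) = H₀ := rfl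
  refine h (Fin 4) C4 SimpleGraph.cycleGraph_connected (-7 / 3) (fun _ => 0)
    (by rw [abs_le]; constructor <;> norm_num) _ ψ₀ ψ₀_mem ψ₀_ne_zero ?_
    ![3 + I, -4 + 2 * I, 3 + I, -2 + I] ?_ ψ₀_poly_zero
  · rw [hH, lowestEnergyInSector_H₀, H₀_mulVec_ψ₀]
    push_cast
    ring_nf
  · intro x
    fin_cases x <;> simp


end Summit.AtomisticToContinuum.BoseEinsteinCondensation.Theorems.GroundStateStability.Negative
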